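import Mathlib
import HarnessLib
import Literature.Probability.MarkovChains.MultipleTryIndependenceSampler
import Literature.Probability.MarkovChains.MultiproposalPeskunBound

/-!
# Multiple-try and pool-selection independence samplers with `K` proposals are Peskun-dominated by
# `K` times the Metropolized independence sampler: `Gap_R ≤ K · Gap_R(IMH)`

[cite: PozzaZanella2025, §2 Example 1 (multiple-try Metropolis is an instance of Algorithm 1),
Example 2 (Tjelmeland's rule); §3.1 Theorem 1, Corollary 1, Remark 1 ("[Yang–Liu] provide a full
spectral analysis of `P^{(K)}` in the specific case of the MTM with independent proposals … proving
an upper bound on `Gap(P^{(K)})` analogous to that given in Corollary 1")]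

The two multi-proposal corrections of the independence sampler in the tree
(`MultipleTryIndependenceSampler.lean`) — the multiple-try Metropolized independence sampler
MTM-IS(`n+1`) of Liu (2001, §5.5.1) / Yang–Liu (2021) (`mtmisKernel q p n`) and the i-SIR /
Barker–Tjelmeland pool-selection rule with `n + 1` fresh proposals (`isirKernel q p (n + 1)`) — are
instances of Pozza–Zanella's general multiproposal kernel (`MultiproposalPeskunBound.mpKernel`)
with the i.i.d. joint proposal `Q(x, ys) = ∏_j q(ys_j)`, whose marginals and their mixture `Q̃` are
all equal to `q`.  Hence the dominating single-proposal kernel `P̃` of Theorem 1 is the plain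
Metropolized independence sampler `mhKernel (fun _ z => q z) p` (IMH), and Theorem 1 / Corollary 1
specialise to: off the diagonal `A^{MTM}(x,y) ≤ (n+1) · A^{IMH}(x,y)` and
`A^{iSIR}(x,y) ≤ (n+1) · A^{IMH}(x,y)`; `Gap_R(A^{MTM}) ≤ (n+1) · Gap_R(A^{IMH})`,
`Gap_R(A^{iSIR}) ≤ (n+1) · Gap_R(A^{IMH})` — `n + 1` proposals per update buy at most a factor
`n + 1` in spectral gap over one IMH update (the total-variation counterpart for MTM-IS,
`(1 − 1/W)^{n+1} ≤ 1 − H_{n+1}(W)`, is `MultipleTryIndependenceSampler.mtmis_rate_ge_imh_pow`,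
Yang–Liu's Theorem 3.2).

## Content (target `p > 0`, model `q > 0` with `Σ q = 1`; finite state space)

* `mpMarginal_iid`, `mpMixture_iid` — for the i.i.d. joint proposal every marginal `Q_i` and the
  mixture `Q̃` equal `q`.
* `mtmisKernel_eq_mpKernel`, `isirKernel_eq_mpKernel` — MTM-IS and i-SIR ARE multiproposal
  kernels in the sense of Pozza–Zanella's Algorithm 1 (selection functions `mtmisSelAcc`,
  `isirSel`).
* **`mtmisKernel_le_mul_imh`**, **`isirKernel_le_mul_imh`** — THEOREM 1 for these samplers.
* **`spectralGapR_mtmis_le_mul_imh`**, **`spectralGapR_isir_le_mul_imh`** — COROLLARY 1 for these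
  samplers.

NOT CLAIMED: sharpness of the factor `n + 1`; dependent / correlated trial mechanisms; anything on
general state spaces.
-/

namespace Literature.Probability.MarkovChains

open Finset

variable {X : Type*} [Fintype X] [DecidableEq X] {p q : X → ℝ}

/-! ## The i.i.d. joint proposal: marginals and mixture -/

/-- For i.i.d. proposals `Q(x, ys) = ∏_j q(ys_j)` from a probability vector `q`, every marginal
`Q_i(x, ·)` is `q`. [cite: PozzaZanella2025, §2 Example 1 (the marginals `Q_i`), §3.1 Remark 1
(MTM with independent proposals: "`Q(x, y_{1:K})` does not depend on `x`")] -/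
theorem mpMarginal_iid (hq1 : ∑ x, q x = 1) {K : ℕ} (i : Fin K) (x y : X) :
    mpMarginal (fun (_ : X) (ys : Fin K → X) => trialProb q ys) i x y = q y := by
  obtain ⟨G, hG⟩ : ∃ G : Fin K → X → ℝ,
      ∀ j a, G j a = if j = i then (if a = y then q a else 0) else q a := ⟨_, fun _ _ => rfl⟩
  have e1 : ∀ ys : Fin K → X,
      (if ys i = y then trialProb q ys else 0) = ∏ j, G j (ys j) := by
    intro ys
    by_cases hy : ys i = y
    · rw [if_pos hy]
      unfold trialProb
      refine prod_congr rfl fun j _ => ?_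
      rw [hG]
      by_cases hj : j = i
      · rw [if_pos hj, hj, if_pos hy]
      · rw [if_neg hj]
    · rw [if_neg hy]
      exact (prod_eq_zero (mem_univ i) (by rw [hG, if_pos rfl, if_neg hy])).symm
  have e2 : ∀ j, ∑ a, G j a = if j = i then q y else 1 := by
    intro j
    by_cases hj : j = i
    · simp_rw [hG, if_pos hj]
      rw [sum_ite_eq' univ y, if_pos (mem_univ _)]
    · simp_rw [hG, if_neg hj]
      exact hq1
  unfold mpMarginal
  calc ∑ ys : Fin K → X, (if ys i = y then trialProb q ys else 0)
      = ∑ ys : Fin K → X, ∏ j, G j (ys j) := sum_congr rfl fun ys _ => e1 ys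
    _ = ∏ j, ∑ a, G j a := (Fintype.prod_sum G).symm
    _ = ∏ j, (if j = i then q y else 1) := prod_congr rfl fun j _ => e2 j
    _ = q y := by rw [prod_ite_eq' univ i, if_pos (mem_univ _)]

/-- Hence the mixture `Q̃ = K⁻¹ Σ_i Q_i` of Theorem 1 is `q` itself (`K ≥ 1`): the dominating
single-proposal kernel is the Metropolized independence sampler with proposal `q`.
[cite: PozzaZanella2025, §3.1 Theorem 1 (definition of `Q̃`), Remark 1] -/
theorem mpMixture_iid (hq1 : ∑ x, q x = 1) {K : ℕ} (hK : 0 < K) :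
    mpMixture (fun (_ : X) (ys : Fin K → X) => trialProb q ys) = fun _ y => q y := by
  funext x y
  unfold mpMixture
  simp_rw [mpMarginal_iid hq1]
  rw [sum_const, card_univ, Fintype.card_fin, nsmul_eq_mul,
    inv_mul_cancel_left₀ (by exact_mod_cast hK.ne')]

/-! ## MTM-IS and i-SIR are multiproposal kernels -/

omit [Fintype X] [DecidableEq X] in
/-- `∏_j q(ys_j) ≥ 0`. [cite: YangLiu2021, §2.2 Algorithm 2 (step 1)] -/
private theorem trialProb_nonneg' (hq : ∀ x, 0 < q x) {n : ℕ} (ys : Fin n → X) :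
    0 ≤ trialProb q ys := by
  unfold trialProb
  exact prod_nonneg fun j _ => (hq _).le

omit [Fintype X] [DecidableEq X] in
/-- `W = Σ_j w(ys_j) ≥ 0`. [cite: YangLiu2021, §2.2 Algorithm 2 (step 3)] -/
private theorem weightSum_nonneg' (hp : ∀ x, 0 < p x) (hq : ∀ x, 0 < q x) {n : ℕ}
    (ys : Fin n → X) : 0 ≤ weightSum q p ys := by
  unfold weightSum
  exact sum_nonneg fun j _ => (div_pos (hp _) (hq _)).le

omit [Fintype X] [DecidableEq X] in
/-- `w(ys_J) ≤ W`. [cite: YangLiu2021, §2.2 Algorithm 2 (step 3)] -/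
private theorem weight_le_weightSum' (hp : ∀ x, 0 < p x) (hq : ∀ x, 0 < q x) {n : ℕ}
    (ys : Fin n → X) (J : Fin n) : p (ys J) / q (ys J) ≤ weightSum q p ys := by
  unfold weightSum
  exact single_le_sum (f := fun j => p (ys j) / q (ys j))
    (fun j _ => (div_pos (hp _) (hq _)).le) (mem_univ J)

omit [Fintype X] [DecidableEq X] in
/-- The MTM-IS select-and-accept probabilities are non-negative.
[cite: YangLiu2021, §2.2 Algorithm 2 (steps 2–4)] -/
theorem mtmisSelAcc_nonneg (hp : ∀ x, 0 < p x) (hq : ∀ x, 0 < q x) {n : ℕ} (x : X)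
    (ys : Fin n → X) (J : Fin n) : 0 ≤ mtmisSelAcc q p x ys J := by
  unfold mtmisSelAcc
  exact mul_nonneg (div_nonneg (div_pos (hp _) (hq _)).le (weightSum_nonneg' hp hq ys))
    (le_min zero_le_one (div_nonneg (weightSum_nonneg' hp hq ys) (by
      linarith [weight_le_weightSum' hp hq ys J, div_pos (hp x) (hq x)])))

omit [Fintype X] [DecidableEq X] in
/-- The MTM-IS select-and-accept probabilities sum to at most one over the selected index (they
are the selection probabilities `w(y_J)/W` thinned by an acceptance probability).
[cite: YangLiu2021, §2.2 Algorithm 2 (steps 2–4)] -/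
theorem sum_mtmisSelAcc_le_one (hp : ∀ x, 0 < p x) (hq : ∀ x, 0 < q x) {n : ℕ} (x : X)
    (ys : Fin (n + 1) → X) : ∑ J, mtmisSelAcc q p x ys J ≤ 1 := by
  rw [← sum_selProb_eq_one hp hq ys]
  refine sum_le_sum fun J _ => ?_
  unfold mtmisSelAcc
  exact mul_le_of_le_one_right
    (div_nonneg (div_pos (hp _) (hq _)).le (weightSum_nonneg' hp hq ys)) (min_le_left _ _)

omit [Fintype X] [DecidableEq X] in
/-- The i-SIR selection probabilities are non-negative. [cite: GreniouxEtAl2023, §2 (i-SIR)] -/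
theorem isirSel_nonneg (hp : ∀ x, 0 < p x) (hq : ∀ x, 0 < q x) {n : ℕ} (x : X)
    (ys : Fin n → X) (J : Fin n) : 0 ≤ isirSel q p x ys J := by
  unfold isirSel
  exact div_nonneg (div_pos (hp _) (hq _)).le
    (add_pos_of_pos_of_nonneg (div_pos (hp x) (hq x)) (weightSum_nonneg' hp hq ys)).le

omit [Fintype X] [DecidableEq X] in
/-- The i-SIR selection probabilities of the fresh proposals sum to `W/(w(x) + W)`.
[cite: GreniouxEtAl2023, §2 (i-SIR: self-normalised weights over the pool)] -/
theorem sum_isirSel_eq (q p : X → ℝ) {n : ℕ} (x : X) (ys : Fin n → X) :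
    ∑ J, isirSel q p x ys J = weightSum q p ys / (p x / q x + weightSum q p ys) := by
  unfold isirSel
  rw [← sum_div]
  rfl

omit [Fintype X] [DecidableEq X] in
/-- The i-SIR selection probabilities of the fresh proposals sum to at most one.
[cite: GreniouxEtAl2023, §2 (i-SIR)] -/
theorem sum_isirSel_le_one (hp : ∀ x, 0 < p x) (hq : ∀ x, 0 < q x) {n : ℕ} (x : X)
    (ys : Fin n → X) : ∑ J, isirSel q p x ys J ≤ 1 := by
  rw [sum_isirSel_eq q p x ys]
  have hW := weightSum_nonneg' hp hq ys
  have hwx := div_pos (hp x) (hq x)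
  rw [div_le_one (by linarith)]
  linarith

/-- **MTM-IS(`n+1`) is the multiproposal kernel of Algorithm 1 with i.i.d. joint proposal
`∏_j q(ys_j)` and selection function `mtmisSelAcc`** (select `∝ w`, then accept with the
generalised M–H ratio). [cite: PozzaZanella2025, §2 Example 1 (multiple-try Metropolis as an
instance of Algorithm 1)]; [cite: Liu2001MonteCarlo, §5.5.1 (MTMIS)] -/
theorem mtmisKernel_eq_mpKernel (hp : ∀ x, 0 < p x) (hq : ∀ x, 0 < q x) (n : ℕ) :
    mtmisKernel q p n =
      mpKernel (fun (_ : X) (ys : Fin (n + 1) → X) => trialProb q ys)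
        (fun x ys J => mtmisSelAcc q p x ys J) := by
  funext x y
  unfold mtmisKernel mpKernel
  congr 1
  split_ifs with hyx
  · unfold mtmisStay mpStay
    refine sum_congr rfl fun ys _ => ?_
    congr 1
    unfold mtmisSelAcc
    simp_rw [mul_sub, mul_one, sum_sub_distrib, sum_selProb_eq_one hp hq ys]
  · rfl

/-- **i-SIR with `n` fresh proposals is the multiproposal kernel of Algorithm 1 with i.i.d. joint
proposal `∏_j q(ys_j)` and Tjelmeland's selection function `isirSel`**
(`h_i = w(y_i)/(w(x) + Σ_j w(y_j))`, the simplified form of the paper's display (acc:pr:tj) for an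
exchangeable proposal). [cite: PozzaZanella2025, §2 Example 2 (Tjelmeland's proposal,
"`h_i(x, y_{1:K}) = π(y_i)/(π(x) + Σ_j π(y_j))`" in the symmetric case)];
[cite: Tjelmeland2004] -/
theorem isirKernel_eq_mpKernel (hp : ∀ x, 0 < p x) (hq : ∀ x, 0 < q x) (n : ℕ) :
    isirKernel q p n =
      mpKernel (fun (_ : X) (ys : Fin n → X) => trialProb q ys) (fun x ys J => isirSel q p x ys J) := by
  funext x y
  unfold isirKernel mpKernel
  congr 1
  split_ifs with hyx
  · unfold isirStay mpStay
    refine sum_congr rfl fun ys _ => ?_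
    congr 1
    have hD : p x / q x + weightSum q p ys ≠ 0 :=
      (add_pos_of_pos_of_nonneg (div_pos (hp x) (hq x)) (weightSum_nonneg' hp hq ys)).ne'
    rw [show (∑ J, (fun x ys J => isirSel q p x ys J) x ys J) = ∑ J, isirSel q p x ys J from rfl,
      sum_isirSel_eq q p x ys, eq_sub_iff_add_eq, ← add_div, div_eq_one_iff_eq hD]
  · rfl

/-! ## Theorem 1 and Corollary 1 for the two samplers -/

/-- **THEOREM 1 for MTM-IS**: off the diagonal the MTM-IS(`n+1`) kernel is at most `n + 1` times
the Metropolized independence sampler, `A^{MTM}(x,y) ≤ (n+1) · A^{IMH}(x,y)` (`x ≠ y`).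
[cite: PozzaZanella2025, §3.1 Theorem 1 with Example 1 and Remark 1] -/
theorem mtmisKernel_le_mul_imh (hp : ∀ x, 0 < p x) (hq : ∀ x, 0 < q x) (hq1 : ∑ x, q x = 1)
    (n : ℕ) {x y : X} (hxy : x ≠ y) :
    mtmisKernel q p n x y ≤ (n + 1) * mhKernel (fun _ z => q z) p x y := by
  have hrev : DetailedBalance p (mpKernel (fun (_ : X) (ys : Fin (n + 1) → X) => trialProb q ys)
      (fun x ys J => mtmisSelAcc q p x ys J)) := by
    rw [← mtmisKernel_eq_mpKernel hp hq n]
    exact mtmisKernel_detailedBalance hp hq n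
  have h1 := mpKernel_offDiag_le hp (fun _ ys => trialProb_nonneg' hq ys)
    (fun x ys J => (single_le_sum (fun j _ => mtmisSelAcc_nonneg hp hq x ys j) (mem_univ J)).trans
      (sum_mtmisSelAcc_le_one hp hq x ys)) hrev hxy
  rw [← mtmisKernel_eq_mpKernel hp hq n, mpMixture_iid hq1 n.succ_pos] at h1
  push_cast at h1
  exact h1

/-- **THEOREM 1 for i-SIR**: `A^{iSIR}(x,y) ≤ (n+1) · A^{IMH}(x,y)` for `x ≠ y`, with `n + 1` fresh
proposals. [cite: PozzaZanella2025, §3.1 Theorem 1 with Example 2] -/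
theorem isirKernel_le_mul_imh (hp : ∀ x, 0 < p x) (hq : ∀ x, 0 < q x) (hq1 : ∑ x, q x = 1)
    (n : ℕ) {x y : X} (hxy : x ≠ y) :
    isirKernel q p (n + 1) x y ≤ (n + 1) * mhKernel (fun _ z => q z) p x y := by
  have hrev : DetailedBalance p (mpKernel (fun (_ : X) (ys : Fin (n + 1) → X) => trialProb q ys)
      (fun x ys J => isirSel q p x ys J)) := by
    rw [← isirKernel_eq_mpKernel hp hq (n + 1)]
    exact isirKernel_detailedBalance hq (n + 1)
  have h1 := mpKernel_offDiag_le hp (fun _ ys => trialProb_nonneg' hq ys)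
    (fun x ys J => (single_le_sum (fun j _ => isirSel_nonneg hp hq x ys j) (mem_univ J)).trans
      (sum_isirSel_le_one hp hq x ys)) hrev hxy
  rw [← isirKernel_eq_mpKernel hp hq (n + 1), mpMixture_iid hq1 n.succ_pos] at h1
  push_cast at h1
  exact h1

/-- **COROLLARY 1 for MTM-IS**: `Gap_R(A^{MTM-IS(n+1)}) ≤ (n+1) · Gap_R(A^{IMH})` — `n + 1`
proposals per update improve the right spectral gap of the Metropolized independence sampler by
at most the factor `n + 1`. [cite: PozzaZanella2025, §3.1 Corollary 1 with Example 1, Remark 1] -/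
theorem spectralGapR_mtmis_le_mul_imh (hp : ∀ x, 0 < p x) (hq : ∀ x, 0 < q x)
    (hq1 : ∑ x, q x = 1) (n : ℕ) :
    spectralGapR p (mtmisKernel q p n : Matrix X X ℝ) ≤
      (n + 1) * spectralGapR p (mhKernel (fun _ z => q z) p : Matrix X X ℝ) := by
  have hrev : DetailedBalance p (mpKernel (fun (_ : X) (ys : Fin (n + 1) → X) => trialProb q ys)
      (fun x ys J => mtmisSelAcc q p x ys J)) := by
    rw [← mtmisKernel_eq_mpKernel hp hq n]
    exact mtmisKernel_detailedBalance hp hq n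
  have h1 := spectralGapR_mpKernel_le hp (fun _ ys => trialProb_nonneg' hq ys)
    (fun x ys J => mtmisSelAcc_nonneg hp hq x ys J) (fun x ys => sum_mtmisSelAcc_le_one hp hq x ys)
    hrev
  rw [← mtmisKernel_eq_mpKernel hp hq n, mpMixture_iid hq1 n.succ_pos] at h1
  push_cast at h1
  exact h1

/-- **COROLLARY 1 for i-SIR**: `Gap_R(A^{iSIR}) ≤ (n+1) · Gap_R(A^{IMH})` with `n + 1` fresh
proposals. [cite: PozzaZanella2025, §3.1 Corollary 1 with Example 2] -/
theorem spectralGapR_isir_le_mul_imh (hp : ∀ x, 0 < p x) (hq : ∀ x, 0 < q x)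
    (hq1 : ∑ x, q x = 1) (n : ℕ) :
    spectralGapR p (isirKernel q p (n + 1) : Matrix X X ℝ) ≤
      (n + 1) * spectralGapR p (mhKernel (fun _ z => q z) p : Matrix X X ℝ) := by
  have hrev : DetailedBalance p (mpKernel (fun (_ : X) (ys : Fin (n + 1) → X) => trialProb q ys)
      (fun x ys J => isirSel q p x ys J)) := by
    rw [← isirKernel_eq_mpKernel hp hq (n + 1)]
    exact isirKernel_detailedBalance hq (n + 1)
  have h1 := spectralGapR_mpKernel_le hp (fun _ ys => trialProb_nonneg' hq ys)
    (fun x ys J => isirSel_nonneg hp hq x ys J) (fun x ys => sum_isirSel_le_one hp hq x ys) hrev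
  rw [← isirKernel_eq_mpKernel hp hq (n + 1), mpMixture_iid hq1 n.succ_pos] at h1
  push_cast at h1
  exact h1

end Literature.Probability.MarkovChains
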